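import Summits.CriticalPhenomena.Ising3DConformalLimit.Theses.HarmonicMomentsIsotropy

/-!
# CriticalPhenomena / Ising3DConformalLimit — route HarmonicMomentsIsotropy, assembly

Settles item `stmt-CriticalPhenomena-6038` (rank 1, assembly of route
`route-CriticalPhenomena-HarmonicMomentsIsotropy`):

`AngularHierarchy → HierarchyClosure → CorrelationLengthWindow → ExistsScaleCovariantLimit →
DilutionTransfer → RotationUpgrade → InversionUpgradeNormalised → IsingEuclidUpgradeR4NonGaussian →
Ising3DConformalLimit`.

Pure logic over the summit's structure predicates
(`Literature/Probability/LatticeModels/ConformalCovariance.lean`,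
`Literature/Probability/LatticeModels/ScalingLimit3D.lean`):
`HarmonicDilution := HierarchyClosure AngularHierarchy`;
`TwoPointAsymptoticIsotropy := DilutionTransfer HarmonicDilution CorrelationLengthWindow
ExistsScaleCovariantLimit`; take `ρ, Δ, S` with its five properties from
`ExistsScaleCovariantLimit`; `RotationUpgrade` applied to the two-point isotropy gives
`IsRotationInvariant S`, hence `IsEuclideanInvariant S := ⟨transl, rot⟩`;
`InversionUpgradeNormalised` gives `IsInversionCovariant Δ S`; `IsMoebiusCovariant Δ S :=
⟨Euclid, scale, inversion⟩` by definition; `IsingEuclidUpgradeR4NonGaussian` gives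
`HasNontrivialU4 S`; conclude `CritIsing3DConformalLimit` (= `Ising3DConformalLimit`, root abbrev of
`Summits/CriticalPhenomena/Ising3DConformalLimit/Statement.lean`).
No named facts are used; the theorem is unconditional bookkeeping.
-/

namespace Summit.CriticalPhenomena.Ising3DConformalLimit.Theorems

open Summit.CriticalPhenomena.Ising3DConformalLimit.Theses.HarmonicMomentsIsotropy
open Literature.Probability.LatticeModels

/-- Settles `stmt-CriticalPhenomena-6038` (exact signature): the assembly
`AngularHierarchy → HierarchyClosure → CorrelationLengthWindow → ExistsScaleCovariantLimit →
DilutionTransfer → RotationUpgrade → InversionUpgradeNormalised → IsingEuclidUpgradeR4NonGaussian →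
Ising3DConformalLimit` of route HarmonicMomentsIsotropy.
Proof: harmonic dilution from `HierarchyClosure AngularHierarchy`; vague two-point isotropy from
`DilutionTransfer`; `ρ, Δ, S` from `ExistsScaleCovariantLimit`; `RotationUpgrade` ⇒
`IsRotationInvariant S`; Euclidean := ⟨transl, rot⟩; `InversionUpgradeNormalised` ⇒ inversion
covariance; Möbius := ⟨Euclid, scale, inversion⟩ (definition of `IsMoebiusCovariant`,
Di Francesco–Mathieu–Sénéchal 1997 §4.3.1); `IsingEuclidUpgradeR4NonGaussian` ⇒ `U₄ ≢ 0`.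
[folklore] -/
theorem harmonicMomentsIsotropy_assembly_proof :
    Summit.CriticalPhenomena.Ising3DConformalLimit.Theses.HarmonicMomentsIsotropy.Assembly := by
  unfold Assembly
  intro hAH hHC hCLW hEX hDT hRU hINV hU4
  have hHD := hHC hAH
  have hISO := hDT hHD hCLW hEX
  obtain ⟨ρ, Δ, S, hρ, hΔ, hlim, hnorm, hnd, htr, hsc⟩ := hEX
  have hrot : IsRotationInvariant S := hRU hISO ρ Δ S hρ hlim hnorm hnd htr hsc
  have heuc : IsEuclideanInvariant S := ⟨htr, hrot⟩
  have hinv : IsInversionCovariant Δ S := hINV ρ Δ S hρ hlim hnorm hnd heuc hsc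
  have hu4 : HasNontrivialU4 S := hU4 ρ S hρ hlim hnd
  exact ⟨ρ, Δ, S, hρ, hΔ, hlim, hnd, ⟨heuc, hsc, hinv⟩, hu4⟩

end Summit.CriticalPhenomena.Ising3DConformalLimit.Theorems
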